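import Literature.Combinatorics.LorentzianPolynomials.RayleighOperations
import HarnessLib

/-!
# The support of a `c`-Rayleigh polynomial is interval convex (Brändén–Huh 2020, §2.4 Lemma 2.22 (1))

Layer `Literature/Combinatorics/LorentzianPolynomials`, namespace `Literature.Combinatorics.LorentzianPolynomials`;
lane `lit-hodgefound` (Track 2 foundations library), seat p16, generation 29 (row g29-#1). Builds on `Rayleigh.lean`
(`IsCRayleigh`, Def. 2.18) and `RayleighOperations.lean` (Lemma 2.20 (1) `IsCRayleigh.pderiv`/`.iterPderiv`, (2)/(4)
`IsCRayleigh.diagScale`). First of the three lemmas preparing Theorem 2.23 (the support of a homogeneous `c`-Rayleigh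
polynomial is M-convex).

## Source (verbatim) — P. Brändén, J. Huh, *Lorentzian polynomials* [BrandenHuh2019] (held `paper:arxiv-1902.03719`)

§2.4 (p. 20): "We introduce a partial order `≤` on `ℕ^n` by setting `α ≤ β ⟺ α_i ≤ β_i` for all `i ∈ [n]`. We say that
a subset `J♮` of `ℕ^n` is *interval convex* if the following implication holds:
`(α ∈ J♮, β ∈ J♮, α ≤ γ ≤ β) ⟹ γ ∈ J♮`." (p. 21) "**Lemma 2.22.** Let `f` be a `c`-Rayleigh polynomial in
`ℝ[w_1, …, w_n]`. (1) The support of `f` is interval convex. (2) If `f(0)` is nonzero, then `supp(f)` is M♮-convex.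
*Proof.* Suppose that the polynomial `f` and the vectors `α ≤ γ ≤ β` constitute a minimal counterexample to (1) with
respect to the degree and the number of variables of `f`. We may and will suppose that `|β|_1` is minimal among all
such `α ≤ γ ≤ β` for the polynomial `f`. We have `α_j = 0` for all `j`, since otherwise some contraction `∂_j f` is a
smaller counterexample to (1). Similarly, we have `β_j > 0` for all `j`, since otherwise some deletion `f ∖ j` is a
smaller counterexample to (1). In addition, we may assume that `γ` is a unit vector, say `γ = e_i`, since otherwise
the contraction `∂_j f` for any `j` satisfying `γ_j > 0` is a smaller counterexample to (1). Suppose `e_j` is in the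
support of `f` for some `j`. In this case, we should have `e_i + e_j ∈ supp(f)`, since otherwise `∂_j f` is a smaller
counterexample to (1). However, the above implies `∂_i f(0) = 0` and `f(0) ∂_i∂_j f(0) > 0`, contradicting the
`c`-Rayleigh property of `f`. Therefore, no `e_j` is in the support of `f`, and hence `|δ|_1 ≥ |β|_1` for all
`δ ∈ supp(f)`, by the minimality of `|β|_1`. Thus, for any indices `k` and `l` satisfying `β ≥ e_k + e_l`, we have
`f(ε, …, ε) = a_1 + higher order terms`, `∂_k f(ε, …, ε) = a_2 ε^{|β|_1 - 1} + higher order terms`,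
`∂_l f(ε, …, ε) = a_3 ε^{|β|_1 - 1} + higher order terms`, `∂_k∂_l f(ε, …, ε) = a_4 ε^{|β|_1 - 2} + higher order terms`,
for some positive constants `a_1, a_2, a_3, a_4`. This contradicts the `c`-Rayleigh property of `f` for sufficiently
small positive `ε`, proving (1)."

## What is here (the printed minimal-counterexample argument, run as inductions)

* §1 `IsIntervalConvex J` (the definition above, for the product order of `σ →₀ ℕ`), unfolding, boxes `Icc`,
  intersections, and "interval convex `∋ 0` ⟹ lower set".
* §2 supports of derivatives: `coeff_β(∂^α f) ≠ 0 ↔ coeff_{α+β} f ≠ 0`, the same for `∂_i`, `(∂^α f)(0) = c_α(f)`, and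
  **Def. 2.18 at `w = 0` in normalized coefficients** `c_α c_{α+e_i+e_j} ≤ c · c_{α+e_i} c_{α+e_j}`
  (`IsCRayleigh.normCoeff_mul_normCoeff_le`) — the source's "`∂_i f(0) = 0` and `f(0) ∂_i∂_j f(0) > 0`, contradicting
  the `c`-Rayleigh property".
* §3 evaluation on the diagonal `(ε, …, ε)`: `f(ε𝟙) = Σ_δ coeff_δ ε^{|δ|}`, the lower bound `coeff_δ ε^{|δ|} ≤ f(ε𝟙)`
  and, when every exponent in `supp f` has `|δ| ≥ m` and `0 ≤ ε ≤ 1`, the upper bound `f(ε𝟙) ≤ (Σ_δ coeff_δ) ε^m`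
  (the source's "`a ε^{|β|-1} +` higher order terms").
* §4 `restrictVars S f`, the deletion `f ∖ j` of every variable `j ∉ S` at once (the dilation by the indicator of `S`,
  Lemma 2.20 (2)/(4)): coefficients and the `c`-Rayleigh property.
* §5 **Lemma 2.22 (1)**: `coeff_single_ne_zero_of_isCRayleigh` (the case `α = 0`, `γ = e_i` — strong induction on
  `|β|` replaces "minimal counterexample"; the deletions `f ∖ j`, `j ∉ S(β)`, replace "minimal number of variables"),
  `coeff_ne_zero_of_le_of_isCRayleigh` (the case `α = 0`, induction on `|γ|` by contractions) and
  **`isIntervalConvex_support_of_isCRayleigh`** (general `α`, by the contraction `∂^α`).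

Two definitions with bodies (`IsIntervalConvex`, `restrictVars`), theorems otherwise; no `sorry`, no named fact. Note
on Lemma 2.20: item (3) of the arXiv v1/v2 statement (diagonalization) is withdrawn as incorrect in the published
version (p. 20, *Remark*, citing [BBL09, §7, Counterexample 1]); nothing here or in the sequel uses it.

## References

* [BrandenHuh2019] P. Brändén, J. Huh, *Lorentzian polynomials*, Ann. of Math. (2) 192 (2020) 821–891, arXiv:1902.03719 —
  §2.4 (interval convexity, p. 20), Lemma 2.22 (1) and its proof (p. 21), Lemma 2.20 (1), (2), (4), Def. 2.18.
-/

noncomputable section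

open MvPolynomial Finsupp Finset

namespace Literature.Combinatorics.LorentzianPolynomials

variable {σ : Type*}

/-! ## §1 Interval convex subsets of `ℕ^n` -/

section IntervalConvex

/-- **Interval convex** subsets of `ℕ^n`: "We say that a subset `J♮` of `ℕ^n` is *interval convex* if the following
implication holds: `(α ∈ J♮, β ∈ J♮, α ≤ γ ≤ β) ⟹ γ ∈ J♮`", for the partial order "`α ≤ β ⟺ α_i ≤ β_i` for all
`i ∈ [n]`" (Mathlib's order on `σ →₀ ℕ`). [cite: BrandenHuh2019, §2.4 (p. 20, before Lemma 2.21)] -/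
def IsIntervalConvex (J : Set (σ →₀ ℕ)) : Prop :=
  ∀ ⦃α β γ : σ →₀ ℕ⦄, α ∈ J → β ∈ J → α ≤ γ → γ ≤ β → γ ∈ J

/-- Unfolding the definition of interval convexity. [cite: BrandenHuh2019, §2.4 (p. 20)] -/
theorem isIntervalConvex_iff (J : Set (σ →₀ ℕ)) :
    IsIntervalConvex J ↔ ∀ ⦃α β γ : σ →₀ ℕ⦄, α ∈ J → β ∈ J → α ≤ γ → γ ≤ β → γ ∈ J :=
  Iff.rfl

/-- The empty set is interval convex. [cite: BrandenHuh2019, §2.4 (p. 20)] -/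
theorem isIntervalConvex_empty : IsIntervalConvex (∅ : Set (σ →₀ ℕ)) :=
  fun _ _ _ h ↦ (Set.notMem_empty _ h).elim

/-- A box `{γ | α ≤ γ ≤ β}` is interval convex. [cite: BrandenHuh2019, §2.4 (p. 20)] -/
theorem isIntervalConvex_Icc (α β : σ →₀ ℕ) : IsIntervalConvex (Set.Icc α β) :=
  fun _ _ _ ha hb hag hgb ↦ ⟨le_trans ha.1 hag, le_trans hgb hb.2⟩

/-- Intersections of interval convex sets are interval convex. [cite: BrandenHuh2019, §2.4 (p. 20)] -/
theorem IsIntervalConvex.inter {J K : Set (σ →₀ ℕ)} (hJ : IsIntervalConvex J) (hK : IsIntervalConvex K) :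
    IsIntervalConvex (J ∩ K) :=
  fun _ _ _ ha hb hag hgb ↦ ⟨hJ ha.1 hb.1 hag hgb, hK ha.2 hb.2 hag hgb⟩

/-- An interval convex set containing `0` is a lower set: with `β` it contains every `γ ≤ β` (the form in which Lemma
2.22 (1) enters the proof of Lemma 2.22 (2): "since `f(0)` is nonzero, we have `α - e_i ∈ supp(f)`").
[cite: BrandenHuh2019, §2.4 proof of Lemma 2.22 (2) (p. 22)] -/
theorem IsIntervalConvex.mem_of_le {J : Set (σ →₀ ℕ)} (hJ : IsIntervalConvex J) (h0 : (0 : σ →₀ ℕ) ∈ J)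
    {β γ : σ →₀ ℕ} (hβ : β ∈ J) (hle : γ ≤ β) : γ ∈ J :=
  hJ (γ := γ) h0 hβ zero_le hle

end IntervalConvex

/-! ## §2 Supports of derivatives; Def. 2.18 at `w = 0` -/

section Support

variable [Fintype σ]

/-- `coeff_β(∂^α f) ≠ 0 ↔ coeff_{α+β}(f) ≠ 0`: `supp(∂^α f) = (supp f - α) ∩ ℕ^n`.
[cite: BrandenHuh2019, §2.4 proof of Lemma 2.22 (the contractions `∂_j f`, `∂^{α-e_i} f`)] -/
theorem coeff_iterPderiv_ne_zero_iff (α β : σ →₀ ℕ) (f : MvPolynomial σ ℝ) :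
    coeff β (iterPderiv α f) ≠ 0 ↔ coeff (α + β) f ≠ 0 := by
  rw [Ne, ← normCoeff_eq_zero_iff, normCoeff_iterPderiv, normCoeff_eq_zero_iff]

omit [Fintype σ] in
/-- `coeff_β(∂_i f) ≠ 0 ↔ coeff_{β+e_i}(f) ≠ 0`: `supp(∂_i f) = (supp f - e_i) ∩ ℕ^n` (the contraction).
[cite: BrandenHuh2019, §2.4 Lemma 2.20 (1), proof of Lemma 2.22] -/
theorem coeff_pderiv_ne_zero_iff (i : σ) (β : σ →₀ ℕ) (f : MvPolynomial σ ℝ) :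
    coeff β (pderiv i f) ≠ 0 ↔ coeff (β + Finsupp.single i 1) f ≠ 0 := by
  rw [coeff_pderiv, mul_ne_zero_iff, and_iff_left]
  positivity

/-- `(∂^α f)(0) = c_α(f)`: the constant term of `∂^α f` is the normalized coefficient `α! coeff_α f`.
[cite: BrandenHuh2019, §2.2 (p. 11, normalized form) and §2.4 proof of Lemma 2.22 ("`∂_i f(0)`")] -/
theorem coeff_zero_iterPderiv (α : σ →₀ ℕ) (f : MvPolynomial σ ℝ) :
    coeff 0 (iterPderiv α f) = normCoeff α f := by
  have h := normCoeff_iterPderiv α 0 f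
  rwa [add_zero, normCoeff_def, factorialProd_zero, one_mul] at h

omit [Fintype σ] in
/-- `f(0, …, 0) = coeff_0 f`. [cite: BrandenHuh2019, §2.4 proof of Lemma 2.22 ("`f(0)`")] -/
theorem eval_zero_eq_coeff_zero (f : MvPolynomial σ ℝ) : eval (fun _ ↦ (0 : ℝ)) f = coeff 0 f := by
  rw [MvPolynomial.eval_zero']
  exact congrFun constantCoeff_eq f

/-- **Def. 2.18 at `w = 0`, in normalized coefficients**: a `c`-Rayleigh `f` has
`c_α(f) · c_{α+e_i+e_j}(f) ≤ c · c_{α+e_i}(f) · c_{α+e_j}(f)` for all `α`, `i`, `j` (evaluate the defining inequality at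
the origin, `(∂^α f)(0) = c_α(f)`). This is the source's "`∂_i f(0) = 0` and `f(0) ∂_i∂_j f(0) > 0`, contradicting the
`c`-Rayleigh property of `f`". [cite: BrandenHuh2019, §2.4 Def. 2.18, proof of Lemma 2.22 (1)] -/
theorem IsCRayleigh.normCoeff_mul_normCoeff_le {c : ℝ} {f : MvPolynomial σ ℝ} (h : IsCRayleigh c f)
    (α : σ →₀ ℕ) (i j : σ) :
    normCoeff α f * normCoeff (α + Finsupp.single i 1 + Finsupp.single j 1) f ≤
      c * (normCoeff (α + Finsupp.single i 1) f * normCoeff (α + Finsupp.single j 1) f) := by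
  have h0 := h.le α i j (w := fun _ ↦ (0 : ℝ)) fun _ ↦ le_rfl
  simpa only [eval_zero_eq_coeff_zero, coeff_zero_iterPderiv] using h0

end Support

/-! ## §3 Evaluation on the diagonal `(ε, …, ε)` -/

section Diagonal

variable [Fintype σ]

/-- `f(ε, …, ε) = Σ_δ coeff_δ(f) ε^{|δ|}`. [cite: BrandenHuh2019, §2.4 proof of Lemma 2.22 (1) ("`f(ε, …, ε) = a_1 +`
higher order terms")] -/
theorem eval_const_eq_sum (ε : ℝ) (f : MvPolynomial σ ℝ) :
    eval (fun _ ↦ ε) f = ∑ δ ∈ f.support, coeff δ f * ε ^ δ.degree := by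
  rw [eval_eq']
  refine Finset.sum_congr rfl fun δ _ ↦ ?_
  rw [Finset.prod_pow_eq_pow_sum, Finsupp.degree_eq_sum]

/-- Lower bound on the diagonal: `coeff_δ(f) ε^{|δ|} ≤ f(ε, …, ε)` for `f` with nonnegative coefficients and `ε ≥ 0`
(the leading term "`a ε^{|δ|}`" of the source). [cite: BrandenHuh2019, §2.4 proof of Lemma 2.22 (1)] -/
theorem coeff_mul_pow_le_eval_const {f : MvPolynomial σ ℝ} (hf : ∀ δ, 0 ≤ coeff δ f) {ε : ℝ} (hε : 0 ≤ ε)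
    (δ : σ →₀ ℕ) : coeff δ f * ε ^ δ.degree ≤ eval (fun _ ↦ ε) f := by
  rw [eval_const_eq_sum]
  by_cases hδ : δ ∈ f.support
  · exact Finset.single_le_sum (f := fun γ ↦ coeff γ f * ε ^ γ.degree)
      (fun γ _ ↦ mul_nonneg (hf γ) (pow_nonneg hε _)) hδ
  · rw [MvPolynomial.notMem_support_iff.1 hδ, zero_mul]
    exact Finset.sum_nonneg fun γ _ ↦ mul_nonneg (hf γ) (pow_nonneg hε _)

/-- Upper bound on the diagonal: if every exponent `δ ∈ supp f` has `|δ| ≥ m`, then for `0 ≤ ε ≤ 1`,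
`f(ε, …, ε) ≤ (Σ_δ coeff_δ f) · ε^m` ("`a ε^{m} +` higher order terms", made effective).
[cite: BrandenHuh2019, §2.4 proof of Lemma 2.22 (1)] -/
theorem eval_const_le_sum_coeff_mul_pow {f : MvPolynomial σ ℝ} (hf : ∀ δ, 0 ≤ coeff δ f) {ε : ℝ} (hε0 : 0 ≤ ε)
    (hε1 : ε ≤ 1) {m : ℕ} (hm : ∀ δ, coeff δ f ≠ 0 → m ≤ δ.degree) :
    eval (fun _ ↦ ε) f ≤ (∑ δ ∈ f.support, coeff δ f) * ε ^ m := by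
  rw [eval_const_eq_sum, Finset.sum_mul]
  refine Finset.sum_le_sum fun δ hδ ↦ ?_
  exact mul_le_mul_of_nonneg_left (pow_le_pow_of_le_one hε0 hε1 (hm δ (MvPolynomial.mem_support_iff.1 hδ))) (hf δ)

end Diagonal

/-! ## §4 Deleting all the variables outside `S` (Lemma 2.20 (2), iterated) -/

section Restrict

variable [Fintype σ] [DecidableEq σ]

/-- **`restrictVars S f = f ∖ (σ ∖ S)`**: the polynomial obtained from `f` by evaluating `w_j = 0` for every `j ∉ S`
(the deletions `f ∖ j` of Lemma 2.20 (2) for all `j ∉ S` at once), realised as the dilation by the indicator of `S`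
so that the variable set stays `σ` ("`β_j > 0` for all `j`, since otherwise some deletion `f ∖ j` is a smaller
counterexample"). [cite: BrandenHuh2019, §2.4 Lemma 2.20 (2), proof of Lemma 2.22 (1)] -/
def restrictVars (S : Finset σ) (f : MvPolynomial σ ℝ) : MvPolynomial σ ℝ :=
  diagScale (fun k ↦ if k ∈ S then 1 else 0) f

/-- `restrictVars S f` is the dilation by the indicator of `S`. [cite: BrandenHuh2019, §2.4 Lemma 2.20 (2), (4)] -/
theorem restrictVars_def (S : Finset σ) (f : MvPolynomial σ ℝ) :
    restrictVars S f = diagScale (fun k ↦ if k ∈ S then 1 else 0) f :=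
  rfl

/-- The coefficients of `f ∖ (σ ∖ S)`: those of `f` at exponents supported in `S`, and `0` otherwise.
[cite: BrandenHuh2019, §2.4 Lemma 2.20 (2)] -/
theorem coeff_restrictVars (S : Finset σ) (f : MvPolynomial σ ℝ) (γ : σ →₀ ℕ) :
    coeff γ (restrictVars S f) = if γ.support ⊆ S then coeff γ f else 0 := by
  rw [restrictVars, coeff_diagScale]
  split_ifs with h
  · rw [Finset.prod_eq_one fun k _ ↦ ?_, one_mul]
    by_cases hk : k ∈ S
    · rw [if_pos hk, one_pow]
    · rw [Finsupp.notMem_support_iff.1 fun hk' ↦ hk (h hk'), pow_zero]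
  · obtain ⟨k, hkγ, hkS⟩ := Finset.not_subset.1 h
    rw [Finset.prod_eq_zero (Finset.mem_univ k) (by rw [if_neg hkS, zero_pow (Finsupp.mem_support_iff.1 hkγ)]),
      zero_mul]

/-- `coeff_γ (f ∖ (σ ∖ S)) = coeff_γ f` when `γ` is supported in `S`. [cite: BrandenHuh2019, §2.4 Lemma 2.20 (2)] -/
theorem coeff_restrictVars_of_subset {S : Finset σ} (f : MvPolynomial σ ℝ) {γ : σ →₀ ℕ} (h : γ.support ⊆ S) :
    coeff γ (restrictVars S f) = coeff γ f := by
  rw [coeff_restrictVars, if_pos h]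

/-- Exponents in `supp (f ∖ (σ ∖ S))` are supported in `S`. [cite: BrandenHuh2019, §2.4 Lemma 2.20 (2)] -/
theorem support_subset_of_coeff_restrictVars_ne_zero {S : Finset σ} {f : MvPolynomial σ ℝ} {γ : σ →₀ ℕ}
    (h : coeff γ (restrictVars S f) ≠ 0) : γ.support ⊆ S := by
  by_contra hs
  rw [coeff_restrictVars, if_neg hs] at h
  exact h rfl

/-- **Lemma 2.20 (2), iterated: `f ∖ (σ ∖ S)` is `c`-Rayleigh whenever `f` is** (a dilation by a vector of
`{0,1}^n ⊆ ℝ^n_{≥0}`, Lemma 2.20 (4)). [cite: BrandenHuh2019, §2.4 Lemma 2.20 (2), (4)] -/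
theorem IsCRayleigh.restrictVars {c : ℝ} {f : MvPolynomial σ ℝ} (h : IsCRayleigh c f) (S : Finset σ) :
    IsCRayleigh c (restrictVars S f) :=
  h.diagScale fun k ↦ by by_cases hk : k ∈ S <;> simp [hk]

end Restrict

/-! ## §5 Lemma 2.22 (1): the support of a `c`-Rayleigh polynomial is interval convex -/

section IntervalConvexSupport

variable [Fintype σ] [DecidableEq σ]

/-- **Lemma 2.22 (1), the case `α = 0`, `γ = e_i`** (to which the printed proof reduces): if `f` is `c`-Rayleigh,
`0 ∈ supp f`, `β ∈ supp f` and `β_i > 0`, then `e_i ∈ supp f`. The printed minimal-counterexample argument, as a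
strong induction on `|β|` (for all `f` at once): after deleting the variables outside `S(β)` (Lemma 2.20 (2)), (i) no
`e_j`, `j ∈ S(β)`, lies in the support — else, by induction for the contraction `∂_j f` (Lemma 2.20 (1)),
`e_i + e_j ∈ supp f`, and Def. 2.18 at `w = 0` reads `0 < f(0) ∂_i∂_j f(0) ≤ c ∂_i f(0) ∂_j f(0) = 0`; (ii) hence, by
induction again, every nonzero `δ ∈ supp f` has `|δ| ≥ |β|`; (iii) for `e_k + e_l ≤ β`, on the diagonal
`f(ε𝟙) ∂_k∂_l f(ε𝟙) ≥ a_1 a_4 ε^{|β|-2}` while `c ∂_k f(ε𝟙) ∂_l f(ε𝟙) ≤ |c| A_2 A_3 ε^{2|β|-2}`, contradicting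
Def. 2.18 for small `ε > 0`. [cite: BrandenHuh2019, §2.4 Lemma 2.22 (1) and its proof (p. 21)] -/
theorem coeff_single_ne_zero_of_isCRayleigh {c : ℝ} {f : MvPolynomial σ ℝ} (h : IsCRayleigh c f)
    (h0 : coeff 0 f ≠ 0) {β : σ →₀ ℕ} (hβ : coeff β f ≠ 0) {i : σ} (hi : 0 < β i) :
    coeff (Finsupp.single i 1) f ≠ 0 := by
  obtain ⟨n, hn⟩ : ∃ n, β.degree = n := ⟨_, rfl⟩
  induction n using Nat.strong_induction_on generalizing f β i with
  | _ n ih =>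
  intro hcon
  -- delete the variables outside `S(β)`
  set f' := restrictVars β.support f with hf'def
  have h' : IsCRayleigh c f' := h.restrictVars _
  have hnn' : ∀ δ, 0 ≤ coeff δ f' := h'.coeff_nonneg
  have h0' : coeff 0 f' ≠ 0 := by
    rw [hf'def, coeff_restrictVars_of_subset f (by rw [Finsupp.support_zero]; exact Finset.empty_subset _)]
    exact h0
  have hβ' : coeff β f' ≠ 0 := by
    rw [hf'def, coeff_restrictVars_of_subset f Finset.Subset.rfl]
    exact hβ
  have hsub : ∀ γ, coeff γ f' ≠ 0 → γ.support ⊆ β.support := fun γ hγ ↦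
    support_subset_of_coeff_restrictVars_ne_zero hγ
  have hi' : coeff (Finsupp.single i 1) f' = 0 := by
    rw [hf'def, coeff_restrictVars_of_subset f ?_]
    · exact hcon
    · exact Finsupp.support_single_subset.trans
        (Finset.singleton_subset_iff.2 (Finsupp.mem_support_iff.2 hi.ne'))
  -- (i) no `e_j`, `j ∈ S(β)`, is in the support of `f'`
  have hA : ∀ j, 0 < β j → coeff (Finsupp.single j 1) f' = 0 := by
    intro j hj
    by_cases hji : j = i
    · rw [hji]; exact hi'
    by_contra hj1
    have hdeg : (β - Finsupp.single j 1).degree < n := by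
      have := degree_sub_single_add_one (α := β) (i := j) hj.ne'
      omega
    have h0j : coeff 0 (pderiv j f') ≠ 0 := by
      rw [coeff_pderiv_ne_zero_iff, zero_add]; exact hj1
    have hβj : coeff (β - Finsupp.single j 1) (pderiv j f') ≠ 0 := by
      rw [coeff_pderiv_ne_zero_iff, tsub_add_cancel_of_le (Finsupp.single_le_iff.2 hj)]; exact hβ'
    have hij : 0 < (β - Finsupp.single j 1 : σ →₀ ℕ) i := by
      rw [Finsupp.tsub_apply, Finsupp.single_eq_of_ne (Ne.symm hji), tsub_zero]; exact hi
    have hij1 := ih _ hdeg (h'.pderiv j) h0j hβj hij rfl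
    rw [coeff_pderiv_ne_zero_iff] at hij1
    -- Def. 2.18 at `w = 0` with `α = 0`: `c_0 c_{e_i+e_j} ≤ c · c_{e_i} c_{e_j} = 0`
    have hR := h'.normCoeff_mul_normCoeff_le 0 i j
    rw [zero_add, zero_add, normCoeff_eq_zero_iff.2 hi', zero_mul, mul_zero] at hR
    have hp1 : 0 < normCoeff 0 f' := normCoeff_pos_iff.2 (lt_of_le_of_ne (hnn' 0) (Ne.symm h0'))
    have hp2 : 0 < normCoeff (Finsupp.single i 1 + Finsupp.single j 1) f' :=
      normCoeff_pos_iff.2 (lt_of_le_of_ne (hnn' _) (Ne.symm hij1))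
    exact absurd hR (not_le.2 (mul_pos hp1 hp2))
  -- (ii) every nonzero exponent in the support of `f'` has total degree `≥ |β|`
  have hB : ∀ δ, coeff δ f' ≠ 0 → δ ≠ 0 → n ≤ δ.degree := by
    intro δ hδ hδ0
    by_contra hlt
    obtain ⟨j, hj⟩ := Finsupp.ne_iff.1 hδ0
    have hδj : δ j ≠ 0 := by simpa using hj
    have hjβ : 0 < β j :=
      Nat.pos_of_ne_zero (Finsupp.mem_support_iff.1 (hsub δ hδ (Finsupp.mem_support_iff.2 hδj)))
    exact (ih δ.degree (not_le.1 hlt) h' h0' hδ (Nat.pos_of_ne_zero hδj) rfl) (hA j hjβ)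
  -- (iii) `|β| ≥ 2`: write `β = e_i + e_l + γ₀`
  have hβne : β ≠ Finsupp.single i 1 := by
    rintro rfl
    exact hβ' hi'
  obtain ⟨l, hl⟩ : ∃ l, Finsupp.single i 1 + Finsupp.single l 1 ≤ β := by
    by_cases h2 : 2 ≤ β i
    · refine ⟨i, Finsupp.le_def.2 fun k ↦ ?_⟩
      rw [Finsupp.add_apply]
      by_cases hk : k = i
      · subst hk; rw [Finsupp.single_eq_same]; omega
      · rw [Finsupp.single_eq_of_ne hk]; exact Nat.zero_le _
    · have hβi : β i = 1 := by omega
      obtain ⟨l, hli, hl⟩ : ∃ l, l ≠ i ∧ β l ≠ 0 := by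
        by_contra hno
        apply hβne
        ext k
        by_cases hk : k = i
        · subst hk; rw [Finsupp.single_eq_same, hβi]
        · rw [Finsupp.single_eq_of_ne hk]
          by_contra hk0
          exact hno ⟨k, hk, hk0⟩
      refine ⟨l, Finsupp.le_def.2 fun k ↦ ?_⟩
      rw [Finsupp.add_apply]
      by_cases hk : k = i
      · subst hk; rw [Finsupp.single_eq_same, Finsupp.single_eq_of_ne (Ne.symm hli)]; omega
      · rw [Finsupp.single_eq_of_ne hk]
        by_cases hkl : k = l
        · subst hkl; rw [Finsupp.single_eq_same]; omega
        · rw [Finsupp.single_eq_of_ne hkl]; exact Nat.zero_le _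
  set γ₀ := β - (Finsupp.single i 1 + Finsupp.single l 1) with hγ₀def
  have hβeq : Finsupp.single i 1 + Finsupp.single l 1 + γ₀ = β := add_tsub_cancel_of_le hl
  set m := γ₀.degree with hmdef
  have hmn : m + 2 = n := by
    have := congrArg Finsupp.degree hβeq
    rw [map_add, map_add, degree_single, degree_single] at this
    omega
  -- the four polynomials `f'`, `∂_i∂_l f'`, `∂_i f'`, `∂_l f'` and the constants `a_1, a_4, A_2, A_3`
  set Q := iterPderiv (Finsupp.single i 1 + Finsupp.single l 1) f' with hQdef
  have hQnn : ∀ δ, 0 ≤ coeff δ Q := fun δ ↦ coeff_iterPderiv_nonneg hnn' _ δ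
  have hRnn : ∀ (k : σ) (δ : σ →₀ ℕ), 0 ≤ coeff δ (iterPderiv (Finsupp.single k 1) f') := fun k δ ↦
    coeff_iterPderiv_nonneg hnn' _ δ
  have ha₁ : 0 < coeff 0 f' := lt_of_le_of_ne (hnn' 0) (Ne.symm h0')
  have ha₄ : 0 < coeff γ₀ Q := by
    refine lt_of_le_of_ne (hQnn γ₀) (Ne.symm ?_)
    rw [hQdef, coeff_iterPderiv_ne_zero_iff, hβeq]
    exact hβ'
  set A : σ → ℝ := fun k ↦ ∑ δ ∈ (iterPderiv (Finsupp.single k 1) f').support,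
    coeff δ (iterPderiv (Finsupp.single k 1) f') with hAdef
  have hA0 : ∀ k, 0 ≤ A k := fun k ↦ Finset.sum_nonneg fun δ _ ↦ hRnn k δ
  set M := |c| * (A i * A l) with hMdef
  have hM : 0 ≤ M := mul_nonneg (abs_nonneg c) (mul_nonneg (hA0 i) (hA0 l))
  -- the small parameter `ε`
  have hP : 0 < coeff 0 f' * coeff γ₀ Q := mul_pos ha₁ ha₄
  have hden : 0 < M + coeff 0 f' * coeff γ₀ Q := by linarith
  set ε := coeff 0 f' * coeff γ₀ Q / (M + coeff 0 f' * coeff γ₀ Q) with hεdef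
  have hε0 : 0 < ε := div_pos hP hden
  have hε1 : ε ≤ 1 := by
    rw [hεdef, div_le_one hden]
    linarith
  have hMε : M * ε < coeff 0 f' * coeff γ₀ Q := by
    rw [hεdef, ← mul_div_assoc, div_lt_iff₀ hden]
    nlinarith
  -- every exponent in `supp ∂_k f'` has total degree `≥ |β| - 1 = m + 1`
  have hdegR : ∀ (k : σ) (δ : σ →₀ ℕ), coeff δ (iterPderiv (Finsupp.single k 1) f') ≠ 0 → m + 1 ≤ δ.degree := by
    intro k δ hδ
    rw [coeff_iterPderiv_ne_zero_iff] at hδ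
    have hne : Finsupp.single k 1 + δ ≠ 0 := by
      intro h0
      have := congrArg (fun γ : σ →₀ ℕ ↦ γ k) h0
      simp only [Finsupp.coe_add, Pi.add_apply, Finsupp.single_eq_same, Finsupp.coe_zero, Pi.zero_apply] at this
      omega
    have := hB _ hδ hne
    rw [map_add, degree_single] at this
    omega
  -- Def. 2.18 on the diagonal `ε𝟙` with `α = 0` and the indices `i`, `l`
  have hw : ∀ k : σ, 0 ≤ (fun _ ↦ ε) k := fun _ ↦ hε0.le
  have hR := h'.le 0 i l hw
  simp only [zero_add, iterPderiv_zero] at hR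
  -- lower bound of the left-hand side
  have hL1 : coeff 0 f' ≤ eval (fun _ ↦ ε) f' := by
    have := coeff_mul_pow_le_eval_const hnn' hε0.le (0 : σ →₀ ℕ)
    rwa [map_zero, pow_zero, mul_one] at this
  have hL2 : coeff γ₀ Q * ε ^ m ≤ eval (fun _ ↦ ε) Q := coeff_mul_pow_le_eval_const hQnn hε0.le γ₀
  have hL : coeff 0 f' * (coeff γ₀ Q * ε ^ m) ≤ eval (fun _ ↦ ε) f' * eval (fun _ ↦ ε) Q :=
    mul_le_mul hL1 hL2 (mul_nonneg ha₄.le (pow_nonneg hε0.le m)) (ha₁.le.trans hL1)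
  -- upper bound of the right-hand side
  have hU1 : ∀ k, eval (fun _ ↦ ε) (iterPderiv (Finsupp.single k 1) f') ≤ A k * ε ^ (m + 1) := fun k ↦
    eval_const_le_sum_coeff_mul_pow (hRnn k) hε0.le hε1 (hdegR k)
  have hU0 : ∀ k, 0 ≤ eval (fun _ ↦ ε) (iterPderiv (Finsupp.single k 1) f') := fun k ↦
    eval_iterPderiv_nonneg hnn' _ hw
  have hU : c * (eval (fun _ ↦ ε) (iterPderiv (Finsupp.single i 1) f') *
      eval (fun _ ↦ ε) (iterPderiv (Finsupp.single l 1) f')) ≤ M * (ε ^ (m + 1) * ε ^ (m + 1)) := by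
    have h1 : eval (fun _ ↦ ε) (iterPderiv (Finsupp.single i 1) f') *
        eval (fun _ ↦ ε) (iterPderiv (Finsupp.single l 1) f') ≤ (A i * ε ^ (m + 1)) * (A l * ε ^ (m + 1)) :=
      mul_le_mul (hU1 i) (hU1 l) (hU0 l) (mul_nonneg (hA0 i) (pow_nonneg hε0.le _))
    calc c * (eval (fun _ ↦ ε) (iterPderiv (Finsupp.single i 1) f') *
          eval (fun _ ↦ ε) (iterPderiv (Finsupp.single l 1) f'))
        ≤ |c| * (eval (fun _ ↦ ε) (iterPderiv (Finsupp.single i 1) f') *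
          eval (fun _ ↦ ε) (iterPderiv (Finsupp.single l 1) f')) :=
          mul_le_mul_of_nonneg_right (le_abs_self c) (mul_nonneg (hU0 i) (hU0 l))
      _ ≤ |c| * ((A i * ε ^ (m + 1)) * (A l * ε ^ (m + 1))) := mul_le_mul_of_nonneg_left h1 (abs_nonneg c)
      _ = M * (ε ^ (m + 1) * ε ^ (m + 1)) := by rw [hMdef]; ring
  -- comparison for the chosen `ε`
  have hsmall : M * (ε ^ (m + 1) * ε ^ (m + 1)) < coeff 0 f' * (coeff γ₀ Q * ε ^ m) := by
    have h1 : ε ^ (m + 2) ≤ ε := by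
      calc ε ^ (m + 2) ≤ ε ^ 1 := pow_le_pow_of_le_one hε0.le hε1 (by omega)
        _ = ε := pow_one ε
    have h2 : M * ε ^ (m + 2) ≤ M * ε := mul_le_mul_of_nonneg_left h1 hM
    have h3 : 0 < ε ^ m := pow_pos hε0 m
    calc M * (ε ^ (m + 1) * ε ^ (m + 1)) = ε ^ m * (M * ε ^ (m + 2)) := by ring
      _ ≤ ε ^ m * (M * ε) := mul_le_mul_of_nonneg_left h2 h3.le
      _ < ε ^ m * (coeff 0 f' * coeff γ₀ Q) := mul_lt_mul_of_pos_left hMε h3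
      _ = coeff 0 f' * (coeff γ₀ Q * ε ^ m) := by ring
  exact lt_irrefl _ (((hR.trans hU).trans_lt hsmall).trans_le hL)

/-- **Lemma 2.22 (1), the case `α = 0`**: if `f` is `c`-Rayleigh and `0 ∈ supp f`, then `supp f` is a lower set —
`β ∈ supp f` and `γ ≤ β` imply `γ ∈ supp f` (induction on `|γ|`: a unit vector `e_j ≤ γ` is in the support by the
previous theorem, and one passes to the contraction `∂_j f`, "since otherwise the contraction `∂_j f` for any `j`
satisfying `γ_j > 0` is a smaller counterexample"). [cite: BrandenHuh2019, §2.4 Lemma 2.22 (1) and its proof (p. 21)] -/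
theorem coeff_ne_zero_of_le_of_isCRayleigh {c : ℝ} {f : MvPolynomial σ ℝ} (h : IsCRayleigh c f)
    (h0 : coeff 0 f ≠ 0) {β γ : σ →₀ ℕ} (hβ : coeff β f ≠ 0) (hle : γ ≤ β) : coeff γ f ≠ 0 := by
  obtain ⟨n, hn⟩ : ∃ n, γ.degree = n := ⟨_, rfl⟩
  induction n generalizing f β γ with
  | zero =>
    rw [Finsupp.degree_eq_zero_iff] at hn
    rw [hn]
    exact h0
  | succ n ih =>
    have hγ0 : γ ≠ 0 := fun hz ↦ by
      rw [hz, map_zero] at hn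
      exact Nat.succ_ne_zero n hn.symm
    obtain ⟨j, hj⟩ := Finsupp.ne_iff.1 hγ0
    have hγj : γ j ≠ 0 := by simpa using hj
    have hγj' : 0 < γ j := Nat.pos_of_ne_zero hγj
    have hβj : 0 < β j := lt_of_lt_of_le hγj' (hle j)
    -- `e_j ∈ supp f`, so `0 ∈ supp ∂_j f`
    have hej : coeff (Finsupp.single j 1) f ≠ 0 := coeff_single_ne_zero_of_isCRayleigh h h0 hβ hβj
    have h0' : coeff 0 (pderiv j f) ≠ 0 := by
      rw [coeff_pderiv_ne_zero_iff, zero_add]; exact hej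
    have hβ' : coeff (β - Finsupp.single j 1) (pderiv j f) ≠ 0 := by
      rw [coeff_pderiv_ne_zero_iff, tsub_add_cancel_of_le (Finsupp.single_le_iff.2 hβj)]; exact hβ
    have hle' : γ - Finsupp.single j 1 ≤ β - Finsupp.single j 1 := tsub_le_tsub_right hle _
    have hdeg : (γ - Finsupp.single j 1).degree = n := by
      have := degree_sub_single_add_one hγj
      omega
    have hγ' := ih (h.pderiv j) h0' hβ' hle' hdeg
    rwa [coeff_pderiv_ne_zero_iff, tsub_add_cancel_of_le (Finsupp.single_le_iff.2 hγj')] at hγ'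

/-- **Brändén–Huh, Lemma 2.22 (1): the support of a `c`-Rayleigh polynomial is interval convex** — `α, β ∈ supp f`
and `α ≤ γ ≤ β` imply `γ ∈ supp f` ("We have `α_j = 0` for all `j`, since otherwise some contraction `∂_j f` is a
smaller counterexample": pass to the `c`-Rayleigh contraction `∂^α f` (Lemma 2.20 (1)), whose support is
`supp f - α`, and apply the case `α = 0`). [cite: BrandenHuh2019, §2.4 Lemma 2.22 (1) (p. 21)] -/
theorem isIntervalConvex_support_of_isCRayleigh {c : ℝ} {f : MvPolynomial σ ℝ} (h : IsCRayleigh c f) :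
    IsIntervalConvex {α | coeff α f ≠ 0} := by
  intro α β γ hα hβ hαγ hγβ
  simp only [Set.mem_setOf_eq] at hα hβ ⊢
  have h0 : coeff 0 (iterPderiv α f) ≠ 0 := by
    rw [coeff_iterPderiv_ne_zero_iff, add_zero]; exact hα
  have hβ' : coeff (β - α) (iterPderiv α f) ≠ 0 := by
    rw [coeff_iterPderiv_ne_zero_iff, add_tsub_cancel_of_le (hαγ.trans hγβ)]; exact hβ
  have hγ' := coeff_ne_zero_of_le_of_isCRayleigh (h.iterPderiv α) h0 hβ' (tsub_le_tsub_right hγβ α)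
  rwa [coeff_iterPderiv_ne_zero_iff, add_tsub_cancel_of_le hαγ] at hγ'

/-- Lemma 2.22 (1) for a `c`-Rayleigh `f` with `f(0) ≠ 0`: `supp f` is a lower set ("since `f(0)` is nonzero, we have
`α - e_i ∈ supp(f)`"). [cite: BrandenHuh2019, §2.4 Lemma 2.22 (1); proof of Lemma 2.22 (2) (p. 22)] -/
theorem IsCRayleigh.coeff_ne_zero_of_le {c : ℝ} {f : MvPolynomial σ ℝ} (h : IsCRayleigh c f)
    (h0 : coeff 0 f ≠ 0) {β γ : σ →₀ ℕ} (hβ : coeff β f ≠ 0) (hle : γ ≤ β) : coeff γ f ≠ 0 :=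
  coeff_ne_zero_of_le_of_isCRayleigh h h0 hβ hle

end IntervalConvexSupport

end Literature.Combinatorics.LorentzianPolynomials

end
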